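import Literature.Topology.FourManifolds.BoundaryCollarMatching

/-!
# Helpers (collar matching with controlled support) for stub `stub_coreIndependence` of line
`lp-by-sphere-system-surgery` for crux `AgkCor6Sufficiency`
(item stmt-SmoothPoincare4-10894, routes CongruenceShadows / GroupTrisection; lead reshape r5)

**Uniqueness of collars with support in a prescribed neighbourhood of the boundary.**  The tree's
ambient uniqueness of collars (`Cobordism.exists_diffeomorph_comp_collar_eq_endCollar`,
`CobordismEndCollarMatching.lean`; Bröcker–Jänich (1982), (13.7); Hirsch (1976), Ch. 8 §1,
Thm. 1.8) matches a collar `e` of the incoming end of a cobordism to the reference collar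
`κ = endCollar C` by `Ψ = κ ∘ S⁻¹ ∘ κ⁻¹`, which by construction is the identity off the compact
piece `κ (M × [0, a₁])`, `a₁ < ε`; the tree's statement does not record this.  §1 re-runs that
proof verbatim with the support clause added; §2 deduces that two explicit collars of `∂W`
(`W` compact) are matched near `∂W` by a self-diffeomorphism of `W` which is the identity off any
prescribed open `N ⊇ ∂W` (the reference slab `κ (∂W × [0, ε))` lies in `N` for `ε` small, by
compactness); §3 is the registered helper stub.  References: Bröcker–Jänich, *Introduction to
Differential Topology* (1982), (13.7) [BrockerJanich1982]; Hirsch, *Differential Topology*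
(1976), Ch. 8 §1, Thm. 1.8 [HirschDT1976].
-/

noncomputable section

-- the prescribed namespace `Summit.<P>.<Sub>.…` duplicates `SmoothPoincare4` (P = Sub)
set_option linter.dupNamespace false

open Set Function ContinuousMap
open scoped Manifold ContDiff Topology

namespace Summit.SmoothPoincare4.SmoothPoincare4.Cruxes.AgkCor6Sufficiency.LpBySphereSystemSurgery

open Literature.Topology.FourManifolds

namespace CoreIndependence

universe u

/-! ## 1. Matching a collar of the incoming end to the reference collar, with support -/

section Cobordism

variable {n : ℕ} {M N : Type u} [TopologicalSpace M] [ChartedSpace (EuclideanSpace ℝ (Fin n)) M]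
  [TopologicalSpace N] [ChartedSpace (EuclideanSpace ℝ (Fin n)) N]

/-- **Matching a collar of the incoming end to the reference collar, with support in the
reference collar slab** (the tree's `Cobordism.exists_diffeomorph_comp_collar_eq_endCollar`,
proof repeated verbatim, recording moreover that `Ψ` is the identity off
`κ (M × [0, ε))`, `κ = X.endCollar C`: indeed `Ψ = κ ∘ S⁻¹ ∘ κ⁻¹` on the collar region of
positive height and the identity elsewhere, and `S⁻¹ = id` above the level `a₁ < ε`).
[cite: BrockerJanich1982, (13.7)] [cite: HirschDT1976, Ch. 8 §1, Thm. 1.8] -/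
theorem cobordism_exists_diffeomorph_comp_collar_eq_endCollar (X : Cobordism n M N)
    [IsManifold (𝓡 n) ∞ M] (C : X.bdry.OpenCollar) {ε : ℝ} (hε : 0 < ε) (e : M × ℝ → X.W) (einv : X.W → M × ℝ)
    (U : Set X.W) (hUo : IsOpen U) (he0 : ∀ m, e (m, 0) = X.inl m)
    (hes : ContMDiffOn ((𝓡 n).prod 𝓘(ℝ, ℝ)) (𝓡∂ (n + 1)) ∞ e (univ ×ˢ Ico 0 ε))
    (heU : MapsTo e (univ ×ˢ Ico (0 : ℝ) ε) U)
    (hUe : ∀ z ∈ U, einv z ∈ (univ : Set M) ×ˢ Ico (0 : ℝ) ε ∧ e (einv z) = z)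
    (hie : ∀ q ∈ (univ : Set M) ×ˢ Ico (0 : ℝ) ε, einv (e q) = q)
    (his : ContMDiffOn (𝓡∂ (n + 1)) ((𝓡 n).prod 𝓘(ℝ, ℝ)) ∞ einv U) :
    ∃ Ψ : X.W ≃ₘ⟮𝓡∂ (n + 1), 𝓡∂ (n + 1)⟯ X.W, (∀ y, Ψ (X.inr y) = X.inr y) ∧
      (∀ m, Ψ (X.inl m) = X.inl m) ∧
      (∀ z, z ∉ (uncurry (X.endCollar C)) '' ((univ : Set M) ×ˢ Ico 0 ε) → Ψ z = z) ∧
      ∃ δ, 0 < δ ∧ δ ≤ ε ∧ ∀ m, ∀ t ∈ Ico 0 δ, Ψ (e (m, t)) = X.endCollar C m t := by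
  -- adapted from `Cobordism.exists_diffeomorph_comp_collar_eq_endCollar`
  -- (Literature/Topology/FourManifolds/CobordismEndCollarMatching.lean), support clause added
  classical
  rcases isEmpty_or_nonempty M with hM | hM
  · exact ⟨Diffeomorph.refl _ X.W ∞, fun y => rfl, fun m => (IsEmpty.false m).elim,
      fun z _ => rfl, ε, hε, le_rfl, fun m => (IsEmpty.false m).elim⟩
  haveI : CompactSpace M := X.compactSpace_of_inl
  obtain ⟨Smap, Sinv, a₁, a₂, δ, ha₂, ha₂₁, ha₁δ, hδε, hS, hSi, hmS, hmSi, hl, hr, hbot, htop,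
    hslab⟩ := X.exists_collar_germ_extension C hε hUo he0 hes heU hUe hie his
  have ha₁ : 0 < a₁ := ha₂.trans ha₂₁
  have ha₂ε : a₂ < ε := (ha₂₁.trans ha₁δ).trans_le hδε
  -- `S⁻¹ = id` above the level `a₁` as well
  have htop' : ∀ q ∈ (univ : Set M) ×ˢ Ici a₁, Sinv q = q := by
    intro q hq
    have hq' : q ∈ (univ : Set M) ×ˢ Ioi (0 : ℝ) := ⟨mem_univ _, ha₁.trans_le hq.2⟩
    conv_lhs => rw [← htop q hq]
    exact hl q hq'
  -- `e = κ ∘ Γ` on the slab, and `Γ` has positive height off the bottom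
  have heΓ : ∀ m, ∀ t ∈ Ico 0 δ,
      X.endCollar C (X.inlBInv (C.proj (e (m, t)))) (C.height (e (m, t))) = e (m, t) :=
    fun m t ht => X.endCollar_inlBInv_proj C (hslab m t ht).1
  -- the two maps
  set Upos : Set X.W := {z | z ∈ C.regionOver X.inlPart ∧ 0 < C.height z} with hUpos
  have hUposo : IsOpen Upos := X.isOpen_regionOver_inter_height_pos C
  set Ψf : X.W → X.W := fun z =>
    if z ∈ Upos then uncurry (X.endCollar C) (Sinv (X.inlBInv (C.proj z), C.height z)) else z
    with hΨf
  set Ψi : X.W → X.W := fun z =>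
    if z ∈ Upos then uncurry (X.endCollar C) (Smap (X.inlBInv (C.proj z), C.height z)) else z
    with hΨi
  have Ψf_pos : ∀ z ∈ Upos,
      Ψf z = uncurry (X.endCollar C) (Sinv (X.inlBInv (C.proj z), C.height z)) :=
    fun z hz => by rw [hΨf]; exact if_pos hz
  have Ψf_neg : ∀ z ∉ Upos, Ψf z = z := fun z hz => by rw [hΨf]; exact if_neg hz
  have Ψi_pos : ∀ z ∈ Upos,
      Ψi z = uncurry (X.endCollar C) (Smap (X.inlBInv (C.proj z), C.height z)) :=
    fun z hz => by rw [hΨi]; exact if_pos hz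
  have Ψi_neg : ∀ z ∉ Upos, Ψi z = z := fun z hz => by rw [hΨi]; exact if_neg hz
  -- mutual inverses
  have hfi : ∀ z, Ψi (Ψf z) = z := by
    intro z
    by_cases hz : z ∈ Upos
    · rw [Ψf_pos z hz, Ψi_pos _ (X.endCollar_conj_mem C hmSi hz)]
      exact X.endCollar_conj_conj C hmSi hr hz
    · rw [Ψf_neg z hz, Ψi_neg z hz]
  have hif : ∀ z, Ψf (Ψi z) = z := by
    intro z
    by_cases hz : z ∈ Upos
    · rw [Ψi_pos z hz, Ψf_pos _ (X.endCollar_conj_mem C hmS hz)]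
      exact X.endCollar_conj_conj C hmS hl hz
    · rw [Ψi_neg z hz, Ψf_neg z hz]
  -- `Ψf ∘ e = κ` and `Ψi ∘ κ = e` on the slab of height `< a₂`
  have hVf : ∀ m, ∀ t ∈ Ico 0 a₂, Ψf (e (m, t)) = X.endCollar C m t := by
    intro m t ht
    have htδ : t ∈ Ico 0 δ := ⟨ht.1, ht.2.trans (ha₂₁.trans ha₁δ)⟩
    rcases ht.1.eq_or_lt with rfl | htpos
    · rw [he0 m, Ψf_neg _ (X.inl_not_mem_regionOver_inter_height_pos C m), X.endCollar_zero]
    · have hmt : ((m, t) : M × ℝ) ∈ (univ : Set M) ×ˢ Ioi (0 : ℝ) := ⟨mem_univ _, htpos⟩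
      have hb := hbot m t ⟨htpos, ht.2.le⟩
      have hpos : 0 < C.height (e (m, t)) := by
        have h := Set.mem_Ioi.1 (hmS hmt).2
        rwa [hb] at h
      have hzU : e (m, t) ∈ Upos := ⟨(hslab m t htδ).1, hpos⟩
      rw [Ψf_pos _ hzU, ← hb, hl (m, t) hmt]
      rfl
  have hVi : ∀ m, ∀ t ∈ Ico 0 a₂, Ψi (X.endCollar C m t) = e (m, t) := by
    intro m t ht
    have htδ : t ∈ Ico 0 δ := ⟨ht.1, ht.2.trans (ha₂₁.trans ha₁δ)⟩
    rcases ht.1.eq_or_lt with rfl | htpos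
    · rw [X.endCollar_zero, Ψi_neg _ (X.inl_not_mem_regionOver_inter_height_pos C m), he0 m]
    · have hzU : X.endCollar C m t ∈ Upos :=
        ⟨X.endCollar_mem_regionOver C m ht.1, by
          show 0 < C.height (X.endCollar C m t)
          rwa [X.height_endCollar C m ht.1]⟩
      rw [Ψi_pos _ hzU, X.inlBInv_proj_endCollar C m ht.1, hbot m t ⟨htpos, ht.2.le⟩]
      exact heΓ m t htδ
  -- smoothness of `Ψf`
  have hBo : IsOpen ((uncurry (X.endCollar C)) '' ((univ : Set M) ×ˢ Icc 0 a₁))ᶜ :=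
    (X.isCompact_image_endCollar C a₁).isClosed.isOpen_compl
  have hκs : ContMDiffOn ((𝓡 n).prod 𝓘(ℝ, ℝ)) (𝓡∂ (n + 1)) ∞ (uncurry (X.endCollar C))
      ((univ : Set M) ×ˢ Ici 0) := X.contMDiffOn_endCollar C
  have hcf : ContMDiff (𝓡∂ (n + 1)) (𝓡∂ (n + 1)) ∞ Ψf := by
    intro z
    rcases X.mem_regionOver_pos_or C a₁ z with hz | ⟨m, rfl⟩ | hz
    · have heq : Ψf =ᶠ[𝓝 z]
          fun z => uncurry (X.endCollar C) (Sinv (X.inlBInv (C.proj z), C.height z)) := by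
        filter_upwards [hUposo.mem_nhds hz] with w hw
        exact Ψf_pos w hw
      exact ((X.contMDiffOn_endCollar_conj C hSi hmSi).contMDiffAt
        (hUposo.mem_nhds hz)).congr_of_eventuallyEq heq
    · -- near `inl m`, `Ψf = κ ∘ einv`
      set O : Set X.W := U ∩ einv ⁻¹' ((univ : Set M) ×ˢ Iio a₂) with hO
      have hOo : IsOpen O := his.continuousOn.isOpen_inter_preimage hUo (isOpen_univ.prod isOpen_Iio)
      have hmU : X.inl m ∈ U := by
        rw [← he0 m]; exact heU ⟨mem_univ _, le_rfl, hε⟩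
      have hmO : X.inl m ∈ O := by
        refine ⟨hmU, ?_⟩
        change einv (X.inl m) ∈ (univ : Set M) ×ˢ Iio a₂
        rw [← he0 m, hie (m, 0) ⟨mem_univ _, le_rfl, hε⟩]
        exact ⟨mem_univ _, ha₂⟩
      have heq : Ψf =ᶠ[𝓝 (X.inl m)] fun w => uncurry (X.endCollar C) (einv w) := by
        filter_upwards [hOo.mem_nhds hmO] with w hw
        obtain ⟨⟨-, h0, -⟩, hew⟩ := hUe w hw.1
        have h := hVf (einv w).1 (einv w).2 ⟨h0, hw.2.2⟩
        rw [Prod.mk.eta, hew] at h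
        exact h
      have hsm : ContMDiffOn (𝓡∂ (n + 1)) (𝓡∂ (n + 1)) ∞
          (fun w => uncurry (X.endCollar C) (einv w)) U :=
        hκs.comp his fun w hw => ⟨mem_univ _, (hUe w hw).1.2.1⟩
      exact (hsm.contMDiffAt (hUo.mem_nhds hmU)).congr_of_eventuallyEq heq
    · have heq : Ψf =ᶠ[𝓝 z] id := by
        filter_upwards [hBo.mem_nhds hz] with w hw
        by_cases hwU : w ∈ Upos
        · rw [Ψf_pos w hwU]
          exact X.endCollar_conj_eq_self C htop' hwU hw
        · exact Ψf_neg w hwU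
      exact contMDiffAt_id.congr_of_eventuallyEq heq
  -- smoothness of `Ψi`
  have hci : ContMDiff (𝓡∂ (n + 1)) (𝓡∂ (n + 1)) ∞ Ψi := by
    intro z
    rcases X.mem_regionOver_pos_or C a₁ z with hz | ⟨m, rfl⟩ | hz
    · have heq : Ψi =ᶠ[𝓝 z]
          fun z => uncurry (X.endCollar C) (Smap (X.inlBInv (C.proj z), C.height z)) := by
        filter_upwards [hUposo.mem_nhds hz] with w hw
        exact Ψi_pos w hw
      exact ((X.contMDiffOn_endCollar_conj C hS hmS).contMDiffAt
        (hUposo.mem_nhds hz)).congr_of_eventuallyEq heq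
    · -- near `inl m`, `Ψi = e ∘ κ⁻¹`
      set V : Set X.W := {z | z ∈ C.regionOver X.inlPart ∧ C.height z < a₂} with hV
      have hVo : IsOpen V := X.isOpen_regionOver_inter_height_lt C a₂
      have hmV : X.inl m ∈ V := by
        refine ⟨C.incl_mem_regionOver X.inlPart (X.inlB_mem_inlPart m), ?_⟩
        show C.height (X.inl m) < a₂
        rw [← X.endCollar_zero C m, X.height_endCollar C m le_rfl]
        exact ha₂
      have heq : Ψi =ᶠ[𝓝 (X.inl m)] fun w => e (X.inlBInv (C.proj w), C.height w) := by
        filter_upwards [hVo.mem_nhds hmV] with w hw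
        obtain ⟨m', t, ht0, rfl⟩ := X.exists_endCollar_eq_of_mem_regionOver C hw.1
        have hta : t < a₂ := by
          have h := hw.2
          change C.height (X.endCollar C m' t) < a₂ at h
          rwa [X.height_endCollar C m' ht0] at h
        rw [hVi m' t ⟨ht0, hta⟩, X.inlBInv_proj_endCollar C m' ht0]
      have hsm : ContMDiffOn (𝓡∂ (n + 1)) (𝓡∂ (n + 1)) ∞
          (fun w => e (X.inlBInv (C.proj w), C.height w)) V := by
        refine hes.comp ((X.contMDiffOn_inlBInv_proj C).mono fun w hw => hw.1) fun w hw => ?_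
        exact ⟨mem_univ _, C.height_nonneg w hw.1.1, hw.2.trans ha₂ε⟩
      exact (hsm.contMDiffAt (hVo.mem_nhds hmV)).congr_of_eventuallyEq heq
    · have heq : Ψi =ᶠ[𝓝 z] id := by
        filter_upwards [hBo.mem_nhds hz] with w hw
        by_cases hwU : w ∈ Upos
        · rw [Ψi_pos w hwU]
          exact X.endCollar_conj_eq_self C htop hwU hw
        · exact Ψi_neg w hwU
      exact contMDiffAt_id.congr_of_eventuallyEq heq
  -- assemble
  refine ⟨{ toFun := Ψf
            invFun := Ψi
            left_inv := hfi
            right_inv := hif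
            contMDiff_toFun := hcf
            contMDiff_invFun := hci }, fun y => ?_, fun m => ?_, fun z hz => ?_, a₂, ha₂, ha₂ε.le,
    fun m t ht => hVf m t ht⟩
  · exact Ψf_neg _ (X.inr_not_mem_regionOver_inter_height_pos C y)
  · exact Ψf_neg _ (X.inl_not_mem_regionOver_inter_height_pos C m)
  · -- support: off `κ (M × [0, ε))` (hence off `κ (M × [0, a₁])`) the map is the identity
    have ha₁ε : a₁ < ε := ha₁δ.trans_le hδε
    have hz' : z ∉ (uncurry (X.endCollar C)) '' ((univ : Set M) ×ˢ Icc 0 a₁) := fun h =>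
      hz (image_mono (prod_mono Subset.rfl (Icc_subset_Ico_right ha₁ε)) h)
    show Ψf z = z
    by_cases hzU : z ∈ Upos
    · rw [Ψf_pos z hzU]
      exact X.endCollar_conj_eq_self C htop' hzU hz'
    · exact Ψf_neg z hzU

end Cobordism

/-! ## 2. Two collars of `∂W` matched by a diffeomorphism supported near `∂W` -/

section Restrict

variable {M P : Type*} {ε ε' : ℝ} {e : M × ℝ → P} {einv : P → M × ℝ} {U : Set P}

/-- **Restricting explicit collar data to a thinner slab**: with `U' = U ∩ einv ⁻¹' (M × (-∞, ε'))`
the data `(e, einv, U')` is a collar of height `ε' ≤ ε` (the three algebraic clauses). [folklore] -/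
theorem collar_restrict (hε'ε : ε' ≤ ε) (heU : MapsTo e (univ ×ˢ Ico (0 : ℝ) ε) U)
    (hUe : ∀ z ∈ U, einv z ∈ (univ : Set M) ×ˢ Ico (0 : ℝ) ε ∧ e (einv z) = z)
    (hie : ∀ q ∈ (univ : Set M) ×ˢ Ico (0 : ℝ) ε, einv (e q) = q) :
    MapsTo e (univ ×ˢ Ico (0 : ℝ) ε') (U ∩ einv ⁻¹' ((univ : Set M) ×ˢ Iio ε')) ∧
      (∀ z ∈ U ∩ einv ⁻¹' ((univ : Set M) ×ˢ Iio ε'),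
        einv z ∈ (univ : Set M) ×ˢ Ico (0 : ℝ) ε' ∧ e (einv z) = z) ∧
      ∀ q ∈ (univ : Set M) ×ˢ Ico (0 : ℝ) ε', einv (e q) = q := by
  have hsub : (univ : Set M) ×ˢ Ico (0 : ℝ) ε' ⊆ (univ : Set M) ×ˢ Ico (0 : ℝ) ε :=
    prod_mono Subset.rfl (Ico_subset_Ico_right hε'ε)
  refine ⟨fun q hq => ⟨heU (hsub hq), ?_⟩, fun z hz => ⟨⟨mem_univ _, (hUe z hz.1).1.2.1, hz.2.2⟩,
    (hUe z hz.1).2⟩, fun q hq => hie q (hsub hq)⟩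
  show einv (e q) ∈ (univ : Set M) ×ˢ Iio ε'
  rw [hie q (hsub hq)]
  exact ⟨mem_univ _, hq.2.2⟩

/-- `Ψ₂⁻¹ ∘ Ψ₁` sends `x` to `y` as soon as `Ψ₁ x = Ψ₂ y`. [folklore] -/
theorem diffeomorph_trans_symm_apply {E' H' : Type*} [NormedAddCommGroup E'] [NormedSpace ℝ E']
    [TopologicalSpace H'] {I : ModelWithCorners ℝ E' H'} {Q : Type*} [TopologicalSpace Q]
    [ChartedSpace H' Q] {Ψ₁ Ψ₂ : Q ≃ₘ⟮I, I⟯ Q} {x y v : Q} (h₁ : Ψ₁ x = v) (h₂ : Ψ₂ y = v) :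
    (Ψ₁.trans Ψ₂.symm) x = y := by
  rw [Diffeomorph.coe_trans, comp_apply, h₁, ← h₂]
  exact Ψ₂.symm_apply_apply _

end Restrict

section Boundary

variable {n : ℕ} {W : Type} [TopologicalSpace W] [T2Space W]
  [ChartedSpace (EuclideanHalfSpace (n + 1)) W] [IsManifold (𝓡∂ (n + 1)) ∞ W] [CompactSpace W]

/-- **Any two collars of `∂W` are matched near `∂W` by a diffeomorphism of `W` supported in a
prescribed neighbourhood of `∂W`** (Bröcker–Jänich (1982), (13.7); Hirsch (1976), Ch. 8 §1,
Thm. 1.8): as the tree's `BoundaryManifold.exists_diffeomorph_comp_collar_eq_collar`, with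
moreover `Ψ = id` off a given open `N ⊇ ∂W`.  Both collars are matched to the reference collar
`κ` of an open collar of `∂W` on a slab `∂W × [0, ε₀)` with `κ (∂W × [0, ε₀)) ⊆ N`
(compactness of `∂W`), by §1, and the two matchings are composed.
[cite: BrockerJanich1982, (13.7)] [cite: HirschDT1976, Ch. 8 §1, Thm. 1.8] -/
theorem boundary_exists_diffeomorph_comp_collar_eq_collar_of_subset
    {N₀ : Set W} (hN₀ : IsOpen N₀) (hbN₀ : (𝓡∂ (n + 1)).boundary W ⊆ N₀)
    {ε₁ : ℝ} (hε₁ : 0 < ε₁) (e₁ : ↥((𝓡∂ (n + 1)).boundary W) × ℝ → W)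
    (einv₁ : W → ↥((𝓡∂ (n + 1)).boundary W) × ℝ)
    (U₁ : Set W) (hU₁ : IsOpen U₁) (he₁0 : ∀ m, e₁ (m, 0) = m.val)
    (he₁s : ContMDiffOn ((𝓡 n).prod 𝓘(ℝ, ℝ)) (𝓡∂ (n + 1)) ∞ e₁ (univ ×ˢ Ico 0 ε₁))
    (he₁U : MapsTo e₁ (univ ×ˢ Ico (0 : ℝ) ε₁) U₁)
    (hUe₁ : ∀ z ∈ U₁, einv₁ z ∈ (univ : Set ↥((𝓡∂ (n + 1)).boundary W)) ×ˢ Ico (0 : ℝ) ε₁ ∧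
      e₁ (einv₁ z) = z)
    (hie₁ : ∀ q ∈ (univ : Set ↥((𝓡∂ (n + 1)).boundary W)) ×ˢ Ico (0 : ℝ) ε₁, einv₁ (e₁ q) = q)
    (hi₁s : ContMDiffOn (𝓡∂ (n + 1)) ((𝓡 n).prod 𝓘(ℝ, ℝ)) ∞ einv₁ U₁)
    {ε₂ : ℝ} (hε₂ : 0 < ε₂) (e₂ : ↥((𝓡∂ (n + 1)).boundary W) × ℝ → W)
    (einv₂ : W → ↥((𝓡∂ (n + 1)).boundary W) × ℝ)
    (U₂ : Set W) (hU₂ : IsOpen U₂) (he₂0 : ∀ m, e₂ (m, 0) = m.val)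
    (he₂s : ContMDiffOn ((𝓡 n).prod 𝓘(ℝ, ℝ)) (𝓡∂ (n + 1)) ∞ e₂ (univ ×ˢ Ico 0 ε₂))
    (he₂U : MapsTo e₂ (univ ×ˢ Ico (0 : ℝ) ε₂) U₂)
    (hUe₂ : ∀ z ∈ U₂, einv₂ z ∈ (univ : Set ↥((𝓡∂ (n + 1)).boundary W)) ×ˢ Ico (0 : ℝ) ε₂ ∧
      e₂ (einv₂ z) = z)
    (hie₂ : ∀ q ∈ (univ : Set ↥((𝓡∂ (n + 1)).boundary W)) ×ˢ Ico (0 : ℝ) ε₂, einv₂ (e₂ q) = q)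
    (hi₂s : ContMDiffOn (𝓡∂ (n + 1)) ((𝓡 n).prod 𝓘(ℝ, ℝ)) ∞ einv₂ U₂) :
    ∃ Ψ : W ≃ₘ⟮𝓡∂ (n + 1), 𝓡∂ (n + 1)⟯ W, (∀ m : (𝓡∂ (n + 1)).boundary W, Ψ m.val = m.val) ∧
      (∀ z, z ∉ N₀ → Ψ z = z) ∧
      ∃ δ, 0 < δ ∧ δ ≤ ε₁ ∧ δ ≤ ε₂ ∧ ∀ m, ∀ t ∈ Ico 0 δ, Ψ (e₁ (m, t)) = e₂ (m, t) := by
  set X := Cobordism.ofBoundaryIncoming n W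
  rcases isEmpty_or_nonempty ↥((𝓡∂ (n + 1)).boundary W) with hM | hM
  · exact ⟨Diffeomorph.refl _ W ∞, fun m => rfl, fun z _ => rfl, min ε₁ ε₂, lt_min hε₁ hε₂,
      min_le_left _ _, min_le_right _ _, fun m => (IsEmpty.false m).elim⟩
  haveI : CompactSpace ↥((𝓡∂ (n + 1)).boundary W) := X.compactSpace_of_inl
  haveI : Nonempty X.bdry.carrier := ⟨X.inlB (Classical.arbitrary _)⟩
  obtain ⟨C⟩ := X.bdry.nonempty_openCollar
  -- a slab of the reference collar inside `N₀`, thinner than both collars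
  have hκc : ContinuousOn (uncurry (X.endCollar C))
      ((univ : Set ↥((𝓡∂ (n + 1)).boundary W)) ×ˢ Ico 0 (min ε₁ ε₂)) :=
    (X.continuousOn_endCollar C).mono (prod_mono Subset.rfl fun _ ht => ht.1)
  obtain ⟨ε₀, hε₀, hε₀le, hκN⟩ := exists_forall_mem_of_continuousOn (lt_min hε₁ hε₂) hκc hN₀
    fun m => by
      show X.endCollar C m 0 ∈ N₀
      rw [X.endCollar_zero]
      exact hbN₀ m.2
  have hε₀₁ : ε₀ ≤ ε₁ := hε₀le.trans (min_le_left _ _)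
  have hε₀₂ : ε₀ ≤ ε₂ := hε₀le.trans (min_le_right _ _)
  -- both collars restricted to the slab of height `ε₀` and matched to `κ`
  obtain ⟨he₁U', hUe₁', hie₁'⟩ := collar_restrict hε₀₁ he₁U hUe₁ hie₁
  obtain ⟨he₂U', hUe₂', hie₂'⟩ := collar_restrict hε₀₂ he₂U hUe₂ hie₂
  obtain ⟨Ψ₁, -, h₁l, h₁s, δ₁, hδ₁, hδ₁ε, h₁⟩ :=
    cobordism_exists_diffeomorph_comp_collar_eq_endCollar X C hε₀ e₁ einv₁ _
      (hi₁s.continuousOn.isOpen_inter_preimage hU₁ (isOpen_univ.prod isOpen_Iio)) he₁0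
      (he₁s.mono (prod_mono Subset.rfl (Ico_subset_Ico_right hε₀₁))) he₁U' hUe₁' hie₁'
      (hi₁s.mono inter_subset_left)
  obtain ⟨Ψ₂, -, h₂l, h₂s, δ₂, hδ₂, hδ₂ε, h₂⟩ :=
    cobordism_exists_diffeomorph_comp_collar_eq_endCollar X C hε₀ e₂ einv₂ _
      (hi₂s.continuousOn.isOpen_inter_preimage hU₂ (isOpen_univ.prod isOpen_Iio)) he₂0
      (he₂s.mono (prod_mono Subset.rfl (Ico_subset_Ico_right hε₀₂))) he₂U' hUe₂' hie₂'
      (hi₂s.mono inter_subset_left)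
  refine ⟨Ψ₁.trans Ψ₂.symm, fun m => diffeomorph_trans_symm_apply (Q := W) (h₁l m) (h₂l m),
    fun z hz => ?_, min δ₁ δ₂, lt_min hδ₁ hδ₂, ((min_le_left _ _).trans hδ₁ε).trans hε₀₁,
    ((min_le_right _ _).trans hδ₂ε).trans hε₀₂, fun m t ht =>
      diffeomorph_trans_symm_apply (Q := W) (h₁ m t ⟨ht.1, ht.2.trans_le (min_le_left _ _)⟩)
        (h₂ m t ⟨ht.1, ht.2.trans_le (min_le_right _ _)⟩)⟩
  -- off `N₀ ⊇ κ (∂W × [0, ε₀))` both matchings are the identity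
  have hzκ : z ∉ (uncurry (X.endCollar C)) ''
      ((univ : Set ↥((𝓡∂ (n + 1)).boundary W)) ×ˢ Ico 0 ε₀) := by
    rintro ⟨⟨m, t⟩, ⟨-, ht⟩, rfl⟩
    exact hz (hκN m t ht)
  exact diffeomorph_trans_symm_apply (Q := W) (h₁s z hzκ) (h₂s z hzκ)

end Boundary

end CoreIndependence

/-! ## 3. The registered helper stub -/

/-- **Collar matching with controlled support** (registered helper stub of
`stub_coreIndependence`): two explicit collars of `∂W`, `W` a compact manifold with boundary,
are matched near `∂W` by a self-diffeomorphism of `W` fixing `∂W` pointwise and equal to the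
identity off a prescribed open neighbourhood of `∂W`.  (A statement PROVED in this file —
`stub_coreIndependenceHelpers` —, not a named fact.) -/
def CoreIndependenceHelpers : Prop :=
  ∀ (n : ℕ) (W : Type) [TopologicalSpace W] [T2Space W] [ChartedSpace (EuclideanHalfSpace (n + 1)) W]
    [IsManifold (𝓡∂ (n + 1)) ∞ W] [CompactSpace W]
    (N₀ : Set W) (_ : IsOpen N₀) (_ : (𝓡∂ (n + 1)).boundary W ⊆ N₀)
    (ε₁ : ℝ) (_ : 0 < ε₁) (e₁ : ↥((𝓡∂ (n + 1)).boundary W) × ℝ → W)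
    (einv₁ : W → ↥((𝓡∂ (n + 1)).boundary W) × ℝ) (U₁ : Set W) (_ : IsOpen U₁)
    (_ : ∀ m, e₁ (m, 0) = m.val)
    (_ : ContMDiffOn ((𝓡 n).prod 𝓘(ℝ, ℝ)) (𝓡∂ (n + 1)) ∞ e₁ (univ ×ˢ Ico 0 ε₁))
    (_ : MapsTo e₁ (univ ×ˢ Ico (0 : ℝ) ε₁) U₁)
    (_ : ∀ z ∈ U₁, einv₁ z ∈ (univ : Set ↥((𝓡∂ (n + 1)).boundary W)) ×ˢ Ico (0 : ℝ) ε₁ ∧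
      e₁ (einv₁ z) = z)
    (_ : ∀ q ∈ (univ : Set ↥((𝓡∂ (n + 1)).boundary W)) ×ˢ Ico (0 : ℝ) ε₁, einv₁ (e₁ q) = q)
    (_ : ContMDiffOn (𝓡∂ (n + 1)) ((𝓡 n).prod 𝓘(ℝ, ℝ)) ∞ einv₁ U₁)
    (ε₂ : ℝ) (_ : 0 < ε₂) (e₂ : ↥((𝓡∂ (n + 1)).boundary W) × ℝ → W)
    (einv₂ : W → ↥((𝓡∂ (n + 1)).boundary W) × ℝ) (U₂ : Set W) (_ : IsOpen U₂)
    (_ : ∀ m, e₂ (m, 0) = m.val)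
    (_ : ContMDiffOn ((𝓡 n).prod 𝓘(ℝ, ℝ)) (𝓡∂ (n + 1)) ∞ e₂ (univ ×ˢ Ico 0 ε₂))
    (_ : MapsTo e₂ (univ ×ˢ Ico (0 : ℝ) ε₂) U₂)
    (_ : ∀ z ∈ U₂, einv₂ z ∈ (univ : Set ↥((𝓡∂ (n + 1)).boundary W)) ×ˢ Ico (0 : ℝ) ε₂ ∧
      e₂ (einv₂ z) = z)
    (_ : ∀ q ∈ (univ : Set ↥((𝓡∂ (n + 1)).boundary W)) ×ˢ Ico (0 : ℝ) ε₂, einv₂ (e₂ q) = q)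
    (_ : ContMDiffOn (𝓡∂ (n + 1)) ((𝓡 n).prod 𝓘(ℝ, ℝ)) ∞ einv₂ U₂),
    ∃ Ψ : W ≃ₘ⟮𝓡∂ (n + 1), 𝓡∂ (n + 1)⟯ W, (∀ m : (𝓡∂ (n + 1)).boundary W, Ψ m.val = m.val) ∧
      (∀ z, z ∉ N₀ → Ψ z = z) ∧
      ∃ δ, 0 < δ ∧ δ ≤ ε₁ ∧ δ ≤ ε₂ ∧ ∀ m, ∀ t ∈ Ico 0 δ, Ψ (e₁ (m, t)) = e₂ (m, t)

/-- **Registered helper stub `stub_coreIndependenceHelpers`** of line `lp-by-sphere-system-surgery`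
(collar matching with controlled support, §2). [cite: BrockerJanich1982, (13.7)] -/
theorem stub_coreIndependenceHelpers : CoreIndependenceHelpers :=
  fun _ _ _ _ _ _ _ _ hN₀ hbN₀ _ hε₁ e₁ einv₁ U₁ hU₁ he₁0 he₁s he₁U hUe₁ hie₁ hi₁s _ hε₂ e₂ einv₂ U₂
      hU₂ he₂0 he₂s he₂U hUe₂ hie₂ hi₂s =>
    CoreIndependence.boundary_exists_diffeomorph_comp_collar_eq_collar_of_subset hN₀ hbN₀ hε₁ e₁
      einv₁ U₁ hU₁ he₁0 he₁s he₁U hUe₁ hie₁ hi₁s hε₂ e₂ einv₂ U₂ hU₂ he₂0 he₂s he₂U hUe₂ hie₂ hi₂s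

end Summit.SmoothPoincare4.SmoothPoincare4.Cruxes.AgkCor6Sufficiency.LpBySphereSystemSurgery

end
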